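import Literature.Computability.QuantumComplexity.JonesFinalGlue
import HarnessLib

/-!
# The digest of an AJL instance (semantic definition) and its specification

Topic `Literature/Computability/QuantumComplexity`; a step in the discharge of
`ajl_jonesApproxProblem_mem_PromiseBQP` (the classical pre-processor of the core family of
`CoreFamily.lean`). For a raw instance `x = ⟨n, b, θn, θd, prec⟩` with size parameter
`t = max (n'/2) (max #letters (max prec 1))`, `n'` the strand number of the compressed word
(`StrandCompress.lean`; `n` itself is binary in the instance), the digest is the string of length
`16 t²` consisting of the one-hot table of the letters of the compressed word (`t` slots of
`2(2t−1)` bits), the pattern of `|α⟩` on `2t`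
strands, and zeros (`digestRaw`, `digest` on encodings). We prove that it meets `DigestSpec`
(`digestSpec_digest`): after this, only its membership in `FP` (and that of the post-processor, and
the uniformity of the core family) separates `mem_PromiseBQP_of_specs` from an unconditional proof.

## References

* D. Aharonov, V. Jones, Z. Landau, Algorithmica 55 (2009), §3.3 [AharonovJonesLandau2009].
-/

noncomputable section

namespace Literature.Computability.QuantumComplexity

open Cryptography BlockKit

namespace AJLCore

/-! ### The digest -/

/-- The compressed instance word as a braid word on its own (few) strands. [cite: AharonovJonesLandau2009, Thm. 3.2] -/
def bF (x : RawJonesInstance) : BraidWord (cword x).1 := toFin (cword x).1 (cword x).2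

/-! ### The compressed strand number is small -/

/-- If no pair below `P` is free, `P ≤ 2·|w|`: every crossing `σ_j` blocks only the pairs `⌊j/2⌋`,
`⌊(j+1)/2⌋`. [folklore] -/
theorem le_two_mul_length_of_not_free (w : List (ℕ × Bool)) (P : ℕ) (hall : ∀ l < P, ¬ Free w l) : P ≤ 2 * w.length := by
  classical
  have hsub : Finset.range P ⊆ w.toFinset.biUnion fun g => ({g.1 / 2, (g.1 + 1) / 2} : Finset ℕ) := by
    intro l hl
    rw [Finset.mem_range] at hl
    have h := hall l hl
    unfold Free at h; push Not at h
    obtain ⟨g, hg, h⟩ := h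
    rw [Finset.mem_biUnion]
    refine ⟨g, List.mem_toFinset.2 hg, ?_⟩
    rw [Finset.mem_insert, Finset.mem_singleton]
    by_cases h1 : g.1 + 1 = 2 * l
    · right; omega
    · by_cases h2 : g.1 = 2 * l
      · left; omega
      · have h3 := h h1 h2; left; omega
  calc P = (Finset.range P).card := (Finset.card_range P).symm
    _ ≤ (w.toFinset.biUnion fun g => ({g.1 / 2, (g.1 + 1) / 2} : Finset ℕ)).card := Finset.card_le_card hsub
    _ ≤ ∑ g ∈ w.toFinset, ({g.1 / 2, (g.1 + 1) / 2} : Finset ℕ).card := Finset.card_biUnion_le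
    _ ≤ ∑ _g ∈ w.toFinset, 2 := Finset.sum_le_sum fun g _ => Finset.card_le_two
    _ = 2 * w.toFinset.card := by rw [Finset.sum_const, smul_eq_mul, Nat.mul_comm]
    _ ≤ 2 * w.length := Nat.mul_le_mul_left _ (List.toFinset_card_le w)

/-- The compression ends with at most `max 3 (4·|w| + 1)` strands. [folklore] -/
theorem compressFuel_le : ∀ (f n : ℕ) (w : List (ℕ × Bool)), n / 2 ≤ f + 1 → (compressFuel f n w).1 ≤ max 3 (4 * w.length + 1)
  | 0, n, w, hf => by show n ≤ _; omega
  | f + 1, n, w, hf => by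
    by_cases h4 : 4 ≤ n
    · cases hfind : findFree (n - 2) w with
      | none =>
        have e : compressFuel (f + 1) n w = (n, w) := by simp [compressFuel, h4, hfind]
        rw [e]
        -- no pair of the braid on `n` strands is free
        have hall : ∀ l < n / 2, ¬ Free w l := by
          intro l hl hfree
          unfold findFree at hfind
          have := List.find?_eq_none.1 hfind l (by rw [List.mem_reverse, List.mem_range]; omega)
          exact this (decide_eq_true hfree)
        have := le_two_mul_length_of_not_free w (n / 2) hall
        show n ≤ _; omega
      | some l =>
        have e : compressFuel (f + 1) n w = compressFuel f (n - 2) (delPair l w) := by simp [compressFuel, h4, hfind]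
        rw [e]
        have := compressFuel_le f (n - 2) (delPair l w) (by omega)
        rwa [delPair, List.length_map] at this
    · have e : compressFuel (f + 1) n w = (n, w) := by simp [compressFuel, h4]
      rw [e]; show n ≤ _; omega

/-- **The compressed braid has at most `max 3 (4·|w| + 1)` strands.** [folklore] -/
theorem compressRaw_le (n : ℕ) (w : List (ℕ × Bool)) : (compressRaw n w).1 ≤ max 3 (4 * w.length + 1) :=
  compressFuel_le _ n w (by omega)

/-- The size parameter of an instance: `max (2·#letters + 2) (max prec 1)` — at least half the
compressed strand number (`compressRaw_le`), the number of letters and the precision; a closed form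
in the unary list-length header and the unary `prec` of the encoding, so polynomial in the input
length. [folklore] -/
def tI (x : RawJonesInstance) : ℕ := max (2 * x.2.1.length + 2) (max x.prec 1)

/-- `tI ≥ 1`. [folklore] -/
theorem one_le_tI (x : RawJonesInstance) : 1 ≤ tI x := by unfold tI; omega

/-- The braid word is at most as long as the raw letter list. [folklore] -/
theorem length_toBraidWord_le (x : RawJonesInstance) : x.toBraidWord.length ≤ x.2.1.length :=
  List.length_filterMap_le _ _

/-- Compression keeps the number of letters. [folklore] -/
theorem length_compressFuel : ∀ (f n : ℕ) (w : List (ℕ × Bool)), (compressFuel f n w).2.length = w.length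
  | 0, _, _ => rfl
  | f + 1, n, w => by
    unfold compressFuel
    split_ifs
    · cases findFree (n - 2) w with
      | none => rfl
      | some l => simp only; rw [length_compressFuel f, delPair, List.length_map]
    · rfl

/-- The compressed word is at most as long as the raw letter list. [folklore] -/
theorem length_bF_le (x : RawJonesInstance) : (bF x).length ≤ x.2.1.length := by
  unfold bF toFin
  refine (List.length_filterMap_le _ _).trans ?_
  unfold cword compressRaw
  rw [length_compressFuel, rawOf, List.length_map]
  exact length_toBraidWord_le x

/-- Hence at most `tI` letters. [folklore] -/
theorem length_bF_le_tI (x : RawJonesInstance) : (bF x).length ≤ tI x :=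
  (length_bF_le x).trans (by unfold tI; omega)

/-- The raw compressed word is the raw form of `bF` (valid instances: all letters in range). [folklore] -/
theorem rawOf_bF (x : RawJonesInstance) (hx : x.IsValid) : rawOf (bF x) = (cword x).2 :=
  rawOf_toFin _ (compressRaw_spec hx.1 hx.2.1 _ (rawOf_lt _)).2.2.1

/-- The table bit at position `v`: slot `v / A`, letter index `v % A` (`A = 2(2t−1)`). [folklore] -/
def tabBitRaw (x : RawJonesInstance) (v : ℕ) : Bool :=
  match (cword x).2[v / A (2 * tI x)]? with
  | some g => decide (2 * g.1 + g.2.toNat = v % A (2 * tI x))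
  | none => false

/-- The table field. [folklore] -/
def tabField (x : RawJonesInstance) : List Bool := (List.range (tI x * A (2 * tI x))).map (tabBitRaw x)

/-- The pattern field: `|α⟩` on `2t` strands. [folklore] -/
def patField (x : RawJonesInstance) : List Bool := List.ofFn (encodePos (ajlAlpha (2 * tI x)))

/-- **The digest of a raw instance.** [cite: AharonovJonesLandau2009, §3.3] -/
def digestRaw (x : RawJonesInstance) : List Bool :=
  tabField x ++ patField x ++ List.replicate (16 * tI x ^ 2 - (tabField x).length - (patField x).length) false

/-- **The digest** of a string: the digest of the decoded instance (empty if none). [cite: AharonovJonesLandau2009, §3.3] -/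
def digest (w : List Bool) : List Bool :=
  match RawJonesInstance.encoding.decode w with
  | some x => digestRaw x
  | none => []

/-! ### Sizes and entries -/

/-- The fields fit into `16 t²`. [folklore] -/
theorem fields_le (x : RawJonesInstance) : (tabField x).length + (patField x).length ≤ 16 * tI x ^ 2 := by
  rw [tabField, patField, List.length_map, List.length_range, List.length_ofFn]
  have ht := one_le_tI x
  unfold A
  have e : 2 * (2 * tI x - 1) = 4 * tI x - 2 := by omega
  rw [e]
  have h1 : tI x * (4 * tI x - 2) ≤ tI x * (4 * tI x) := Nat.mul_le_mul_left _ (Nat.sub_le _ _)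
  nlinarith

/-- The digest has length `16 t²`. [folklore] -/
theorem length_digestRaw (x : RawJonesInstance) : (digestRaw x).length = 16 * tI x ^ 2 := by
  have := fields_le x
  unfold digestRaw; rw [List.length_append, List.length_append, List.length_replicate]; omega

/-- Entries of the digest in the table field. [folklore] -/
theorem digestRaw_getElem_tab (x : RawJonesInstance) {v : ℕ} (hv : v < tI x * A (2 * tI x)) (h : v < (digestRaw x).length) :
    (digestRaw x)[v] = tabBitRaw x v := by
  have hlen : v < (tabField x).length := by rw [tabField, List.length_map, List.length_range]; exact hv
  unfold digestRaw
  rw [List.getElem_append_left (by rw [List.length_append]; omega), List.getElem_append_left hlen]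
  simp [tabField]

/-- Entries of the digest in the pattern field. [folklore] -/
theorem digestRaw_getElem_pat (x : RawJonesInstance) (i : Fin (2 * (2 * tI x + 1))) (h : tI x * A (2 * tI x) + i < (digestRaw x).length) :
    (digestRaw x)[tI x * A (2 * tI x) + (i : ℕ)] = encodePos (ajlAlpha (2 * tI x)) i := by
  have hlen : (tabField x).length = tI x * A (2 * tI x) := by rw [tabField, List.length_map, List.length_range]
  have hlen' : (patField x).length = 2 * (2 * tI x + 1) := by rw [patField, List.length_ofFn]
  unfold digestRaw
  rw [List.getElem_append_left (by rw [List.length_append, hlen, hlen']; have := i.2; omega),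
    List.getElem_append_right (by rw [hlen]; omega)]
  simp only [patField, hlen, Nat.add_sub_cancel_left, List.getElem_ofFn]

-- the digest is data: never unfold it again (unfolding normalises a `16 t²`-long list symbolically)
attribute [irreducible] digestRaw

/-- The size parameter read off the digest length is `tI`. [folklore] -/
theorem tOf_length_digestRaw (x : RawJonesInstance) : tOf (digestRaw x).length = tI x := by
  rw [length_digestRaw, tOf, show 16 * tI x ^ 2 / 16 = tI x ^ 2 by omega, Nat.sqrt_eq']

/-- The digest of an encoding. [folklore] -/
theorem digest_encode (x : RawJonesInstance) : digest (RawJonesInstance.encoding.encode x) = digestRaw x := by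
  rw [digest, RawJonesInstance.encoding.decode_encode]

/-- The compressed strands fit: `n' ≤ 2t`. [folklore] -/
theorem n_le (x : RawJonesInstance) : (cword x).1 ≤ 2 * tI x := by
  have h1 : (cword x).1 ≤ max 3 (4 * (rawOf x.toBraidWord).length + 1) := compressRaw_le _ _
  have h2 : (rawOf x.toBraidWord).length ≤ x.2.1.length := by rw [rawOf, List.length_map]; exact length_toBraidWord_le x
  unfold tI; omega

/-! ### List helpers -/

/-- `reduceOption` of `some`s. [folklore] -/
theorem reduceOption_map_some' {α : Type*} : ∀ l : List α, (l.map some).reduceOption = l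
  | [] => rfl
  | a :: l => by rw [List.map_cons, List.reduceOption_cons_of_some, reduceOption_map_some' l]

/-- `reduceOption` of `none`s. [folklore] -/
theorem reduceOption_replicate_none' {α : Type*} : ∀ k : ℕ, (List.replicate k (none : Option α)).reduceOption = []
  | 0 => rfl
  | k + 1 => by rw [List.replicate_succ, List.reduceOption_cons_of_none, reduceOption_replicate_none' k]

/-- A function on `Fin r` listing a prefix `l` and then nothing spells `l`. [folklore] -/
theorem reduceOption_ofFn_prefix {α : Type*} {r : ℕ} (l : List α) (hl : l.length ≤ r) (β : Fin r → Option α)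
    (hβ : ∀ s : Fin r, β s = if h : (s : ℕ) < l.length then some l[(s : ℕ)] else none) : (List.ofFn β).reduceOption = l := by
  have e : List.ofFn β = l.map some ++ List.replicate (r - l.length) none := by
    apply List.ext_getElem
    · rw [List.length_ofFn, List.length_append, List.length_map, List.length_replicate]; omega
    · intro i h1 h2
      rw [List.getElem_ofFn, hβ]
      by_cases hi : i < l.length
      · rw [dif_pos hi, List.getElem_append_left (by rw [List.length_map]; exact hi)]; simp
      · rw [dif_neg hi, List.getElem_append_right (by rw [List.length_map]; omega)]; simp
  rw [e, List.reduceOption_append, reduceOption_map_some', reduceOption_replicate_none', List.append_nil]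

/-! ### The specification -/

/-- **The digest meets the specification.** [cite: AharonovJonesLandau2009, §3.3] -/
theorem digestSpec_digest : DigestSpec digest := by
  refine ⟨fun x hx => ?_⟩
  rw [digest_encode]
  have hlen := length_digestRaw x
  have htabv : ∀ {v : ℕ} (hv : v < tI x * A (2 * tI x)) (h : v < (digestRaw x).length), (digestRaw x)[v] = tabBitRaw x v :=
    fun hv h => digestRaw_getElem_tab x hv h
  have hpatv := digestRaw_getElem_pat x
  have hfields := fields_le x
  rw [tabField, List.length_map, List.length_range, patField, List.length_ofFn] at hfields
  -- from here on the digest is an opaque string `d`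
  generalize hd : digestRaw x = d at hlen htabv hpatv ⊢
  -- sizes
  have ht : tOf d.length = tI x := by rw [hlen, tOf, show 16 * tI x ^ 2 / 16 = tI x ^ 2 by omega, Nat.sqrt_eq']
  have hpos : 1 ≤ tOf d.length := by rw [ht]; exact one_le_tI x
  have hfit : Fits d.length := fits_of_pos hpos
  have hr : rOf d.length = tI x := ht
  have hn2 : nOf d.length = 2 * tI x := by rw [nOf, ht]
  have hApos : 0 < A (2 * tI x) := by have := one_le_tI x; unfold A; omega
  -- the table bits
  have hA : A (nOf d.length) = A (2 * tI x) := by rw [hn2]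
  have hraw : (cword x).2 = rawOf (bF x) := (rawOf_bF x hx).symm
  have htab : ∀ (s : Fin (rOf d.length)) (p : Fin (nOf d.length - 1) × Bool),
      tabBit _ hfit d.get s p = (match (rawOf (bF x))[(s : ℕ)]? with
        | some g => decide (2 * g.1 + g.2.toNat = BlockGeom.idx p)
        | none => false) := by
    intro s p
    have hs : (s : ℕ) < tI x := by have := s.2; omega
    have hidx : BlockGeom.idx p < A (2 * tI x) := by have := BlockGeom.idx_lt p; rwa [hA] at this
    have hv : (s : ℕ) * A (2 * tI x) + BlockGeom.idx p < tI x * A (2 * tI x) := by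
      have : ((s : ℕ) + 1) * A (2 * tI x) ≤ tI x * A (2 * tI x) := Nat.mul_le_mul_right _ hs
      nlinarith
    have e : tabPos d.length s p = (s : ℕ) * A (2 * tI x) + BlockGeom.idx p := by rw [tabPos, hA]
    unfold tabBit
    rw [List.get_eq_getElem]
    simp only [e]
    rw [htabv hv, tabBitRaw, hraw]
    have hdiv : ((s : ℕ) * A (2 * tI x) + BlockGeom.idx p) / A (2 * tI x) = s := by
      rw [Nat.add_comm, Nat.add_mul_div_right _ _ hApos, Nat.div_eq_of_lt hidx, zero_add]
    have hmod : ((s : ℕ) * A (2 * tI x) + BlockGeom.idx p) % A (2 * tI x) = BlockGeom.idx p := by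
      rw [Nat.add_comm, Nat.add_mul_mod_self_right, Nat.mod_eq_of_lt hidx]
    simp only [hdiv, hmod]
  -- well-formedness
  have hW : WF d.length d.get := by
    refine ⟨hpos, fun s p p' h1 h2 => ?_⟩
    rw [htab] at h1 h2
    cases hg : (rawOf (bF x))[(s : ℕ)]? with
    | none => rw [hg] at h1; exact absurd h1 Bool.false_ne_true
    | some g =>
    rw [hg] at h1 h2
    simp only [decide_eq_true_eq] at h1 h2
    have : BlockGeom.idx p = BlockGeom.idx p' := h1.symm.trans h2
    unfold BlockGeom.idx at this
    obtain ⟨i, σ⟩ := p; obtain ⟨i', σ'⟩ := p'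
    have : (i : ℕ) = i' ∧ σ = σ' := by cases σ <;> cases σ' <;> simp at this ⊢ <;> omega
    exact Prod.ext (Fin.ext this.1) this.2
  have hnle : (cword x).1 ≤ nOf d.length := by rw [hn2]; exact n_le x
  have hble : (bF x).length ≤ rOf d.length := by rw [hr]; exact length_bF_le_tI x
  refine ⟨hW, by rw [ht]; unfold tI; omega, hnle, ?_, ?_⟩
  · -- the word: slot `s` holds letter `b[s]` for `s < |b|`, nothing after
    have hβ : ∀ s : Fin (rOf d.length), βOf _ (fits_of_pos hW.pos) d.get s =
        if h : (s : ℕ) < (castWord hnle (bF x)).length then some (castWord hnle (bF x))[(s : ℕ)] else none := by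
      intro s
      have key := fun p => (tabBit_eq_decide hW s p).symm.trans (htab s p)
      -- `key p : decide (β s = some p) = [the letter at slot s has index idx p]`
      have hlenc : (castWord hnle (bF x)).length = (bF x).length := by rw [castWord, List.length_map]
      have hlenr : (rawOf (bF x)).length = (bF x).length := by rw [rawOf, List.length_map]
      by_cases hs : (s : ℕ) < (bF x).length
      · rw [dif_pos (by rw [hlenc]; exact hs)]
        have hg : (rawOf (bF x))[(s : ℕ)]? = some ((((bF x)[(s : ℕ)]).1 : ℕ), ((bF x)[(s : ℕ)]).2) := by
          rw [List.getElem?_eq_getElem (by rw [hlenr]; exact hs)]; simp [rawOf]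
        have hval : 2 * (((bF x)[(s : ℕ)]).1 : ℕ) + ((bF x)[(s : ℕ)]).2.toNat =
            BlockGeom.idx ((castWord hnle (bF x))[(s : ℕ)]'(by rw [hlenc]; exact hs)) := by
          simp only [BlockGeom.idx, castWord, List.getElem_map, Fin.val_castLE]
        have h1 := key ((castWord hnle (bF x))[(s : ℕ)]'(by rw [hlenc]; exact hs))
        rw [hg] at h1
        simp only [hval, decide_true, decide_eq_true_eq] at h1
        exact h1
      · rw [dif_neg (by rw [hlenc]; exact hs)]
        cases hβs : βOf _ (fits_of_pos hW.pos) d.get s with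
        | none => rfl
        | some p =>
          have h1 := key p
          rw [hβs, List.getElem?_eq_none (by rw [hlenr]; exact not_lt.1 hs)] at h1
          simp at h1
    show (List.ofFn (βOf _ (fits_of_pos hW.pos) d.get)).reduceOption = castWord hnle (bF x)
    exact reduceOption_ofFn_prefix _ (by rw [castWord, List.length_map]; exact hble) _ hβ
  · -- the pattern
    funext i
    have e : patPos d.length i = tI x * A (2 * tI x) + i := by rw [patPos, hr, hA]
    have e2 : 2 * (nOf d.length + 1) = 2 * (2 * tI x + 1) := by rw [hn2]
    have hi : tI x * A (2 * tI x) + (i : ℕ) < d.length := by have hi2 := i.2; omega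
    unfold patOf
    rw [List.get_eq_getElem]
    simp only [e]
    -- transport along `nOf = 2 t`
    have key : ∀ (N : ℕ) (hN : N = 2 * tI x) (j : Fin (2 * (N + 1))) (hj : tI x * A (2 * tI x) + (j : ℕ) < d.length),
        d[tI x * A (2 * tI x) + (j : ℕ)] = encodePos (ajlAlpha N) j := by
      intro N hN j hj; subst hN; exact hpatv j hj
    exact key _ hn2 i hi

end AJLCore

end Literature.Computability.QuantumComplexity

end
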